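import Summits.QuantumFields.YangMills.Theorems.BalabanUVNodesN15KingModelFullPropagatorBackwardLetters
import Summits.QuantumFields.YangMills.Theorems.BalabanUVNodesN15CurvedDressedPairDefectKingTorus
import Summits.QuantumFields.YangMills.Theorems.BalabanUVNodesN15VectorPieceBackgroundMatrix

/-!
# BalabanUVNodes ∕ N15 — THE KING-MODEL RUNG, PART Ω-b: KING's OBJECTS ON dag-n15-w3's TORUS PAIRING — the nine scalar letters at ONE `(β, δ, m)`, the
# componentwise lifts `A₀⁻¹ ⊗ 1_ι`, `(cast∘A₀′⁻¹∘cast⁻¹) ⊗ 1_ι`, and the flat-point dictionary identifying the curved knit's covariant pieces `D^±_{1}G` with the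
# rung's `N∇_μA₀⁻¹`, `S_{−μ}N∇_μA₀⁻¹` (objects and operator identities for the King inhabitant of `CurvedSpecies.hasMaj_idef_curvDressed_kingTorus`, part Ω-c)

HONEST FRAMING.  Count-neutral helper (cell `pub-ymgap`, seat `pub-ymgap-dag-n15-e` g14; `--supports stmt-QuantumFields-20544 --as helper` = K3⁷
`SpineGivenEndpointR13SepCoPH`; FAN-OUT v1.1 §N15 s3 «KING-MODEL ∕ RIEMANN-KERNEL RUNG»; dag-n15-w3's ask (α), bus 2026-08-28).  TEMPLATE LITERATURE, `A = 0`: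
C. King's scalar U(1)-Higgs MODEL on finite tori ([King1986] (2.13) p. 653, (4.1)–(4.5) p. 670).  dag-n15-w3's END statement of the curved line,
`CurvedSpecies.hasMaj_idef_curvDressed_kingTorus` (`…N15CurvedDressedPairDefectKingTorus`), bounds the η-defect of Bałaban's DRESSED PAIRS `X̂(e^{η′Z′}U′)` vs
`X̂(e^{ηZ}U)` ((3.63)–(3.65) mechanism) on King's torus pairing `blockOf L M : Tor (fine L M) → Tor M`, displaying as HYPOTHESES: the [B6] carrier, the
INDUCTIVE DATUM — block majorants `βe^{−δd}` of `G(U)`, `D⁺_{R}G(U)`, `D⁻_{R}G(U)` on both grids and their three η-defects `≤ m e^{−δd}` — generator letters,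
regimes and a Neumann smallness.  Part Ω-c INHABITS that hypothesis list with a GENUINE multi-level propagator; THIS FILE builds its objects: the coarse torus is the rung's η-run
`Tor (fine (L^K) M₀)` (cube `M₀ ≡ 2L^e`, `K ≥ 1` levels), the fine torus dag-n15-w3's `Tor (fine L (fine (L^K) M₀))` = the rung's `(K+1)`-run through part Ω-a's cast,
`η′ = L^{−(K+1)}` (`η = Lη′ = L^{−K}`), `G = A₀⁻¹ ⊗ 1_ι = tensorId ι A₀⁻¹`, `G′ = (cast∘A₀′⁻¹∘cast⁻¹) ⊗ 1_ι` (dag-n15-c's componentwise lift `tensorId`, with its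
majorant ∕ defect transfer `hasMaj_tensorId` ∕ `idef_tensorId`); at the FLAT base point `W′ ≡ 0` the transporter is `1` (`expTrField_zero`), so the knit's covariant
pieces are the plain quotients (`covPieces_one`), which §3 identifies with the rung's `N∇_μA₀⁻¹` (forward) and `S_{−μ}N∇_μA₀⁻¹` (backward, part Ω-a) on both grids,
the fine ones through the cast; §1 packages part Ω-a's ∕ Σ-a's ∕ Σ-d's nine scalar letters (Ψ-e, P″, Q4a, the backward pieces) at ONE `(β, δ, m)`.
* §1 ★ `kingFullProp_uniform_layer_backward` (the nine scalar letters at ONE `(β, δ, m)`, every `K, n ≥ 1`).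
* §2 `fgrad_liftEquiv_comp_tensorId`, `bgrad_liftEquiv_comp_tensorId`, `expTrField_zero`, `blockMeanField_zero` (the flat-point ∕ lift dictionary).
* §3 `kingGOp₁` (`A₀′⁻¹` one level up, read on dag-n15-w3's fine torus), `kingGT`, `kingGT₁` (the lifts); `kingTorusLine_unitVec_eq`, `fgrad_comp_conj`,
  `pullBack_comp_conj`, `blockOf_castT_symm`, `pull_castSymm_pull_blockOf`, ★ `idef_conj_eq`, `inv_etaFine`, `inv_etaCoarse`; the four ★ `covPieces_flat_*` identities.
0 `sorry`, standard axioms; three plumbing `def`s (`kingGOp₁`, `kingGT`, `kingGT₁`).  HONEST SCOPE: `A = 0`, periodic b.c., odd `L ≥ 3`, cubes `2L^e`, `K ≥ 1`, one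
blocking step (`n = 1`), `0 < m² ≤ m₀²`, `0 < γ < 1`, `0 < α < 1`; abelian∕constant transporter at a FLAT base point — NOT a curved base point, NOT Bałaban's `G(U)`,
NOT the (C3) n-fold transport; a positive control, not an estimate of the real lineage; not a discharge of N15; NE2⁺ NOT PRINTED ∕ not proved; one finite 𝕋⁴
programme at fixed ε — nothing continuum ∕ ℝ⁴ ∕ OS ∕ mass-gap ∕ Clay.
Locators: [Balaban1985BackgroundPropagators] Thm 3.1 (3.42)–(3.43) pp. 397–398, (3.35)–(3.37) p. 396, (3.52)–(3.53) p. 400, (3.63)–(3.65) pp. 402–403 (shapes,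
mechanism); [King1986] (2.13)–(2.17) p. 653, (2.20) p. 654, Thm 3.3 p. 655, (3.7)–(3.8) p. 656, p. 664 (pairing), Prop. 3.9 (3.73) p. 665; [Balaban1983RegularityDecay]
(1.9)–(1.10) p. 573; [Balaban1984PropagatorsII] (2.51) p. 232, (2.156) p. 250.
-/

noncomputable section

namespace Summit.QuantumFields.YangMills.BalabanUVNodes.N15KingModelRung.Curved

open Real Finset Matrix NormedSpace
open Literature.MathematicalPhysics.QuantumFieldTheory.Balaban1983to89
open Literature.MathematicalPhysics.QuantumFieldTheory.Balaban1983to89.B11SectG (BlockNorm HasMaj RowSum)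
open Literature.MathematicalPhysics.QuantumFieldTheory.Balaban1983to89.B6RandomWalk (Triangle254)
open Literature.MathematicalPhysics.QuantumFieldTheory.Balaban1983to89.B6UnitTorusCarrier (unitTorusGeo triangle254_unitTorusGeo rowSum_unitTorusGeo)
open Literature.MathematicalPhysics.QuantumFieldTheory.Balaban1983to89.T4EtaRateDefect (idef idef_apply idef_comp)
open Literature.MathematicalPhysics.QuantumFieldTheory.Balaban1983to89.T4EtaRateCoeffDefect (pull pull_apply)
open Literature.MathematicalPhysics.QuantumFieldTheory.Balaban1983to89.B5Prop11Plancherel (Tor fine unitVec)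
open Literature.MathematicalPhysics.QuantumFieldTheory.King1986 (aK)
open Literature.MathematicalPhysics.QuantumFieldTheory.King1986.Torus (fineOp blockOf tdistT tdistT_nonneg)
open Summit.QuantumFields.YangMills.BalabanUVNodes.N15.VectorPiece (unitTorusGeoS tensorId tensorId_apply hasMaj_tensorId idef_tensorId)
open Summit.QuantumFields.YangMills.BalabanUVNodes.N15.MatrixSpecies (liftMap liftBlk liftEquiv liftEquiv_apply liftEquiv_symm_apply coordMat basisConst Phi0)
open Summit.QuantumFields.YangMills.BalabanUVNodes.N15.BackgroundLayer (fgrad bgrad liftPair blkPair coordMat_smul coordMat_one)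
open Summit.QuantumFields.YangMills.BalabanUVNodes.N15.CurvedSpecies (torStep blockMeanField blockMeanTV covPieces covPieces_one gaugePair gaugePair_one
  curvDressed expTrField expTrField_apply expRowLetter expFitLetter torStep_symm_apply hasMaj_idef_curvDressed_kingTorus)

variable {d : ℕ} (L : ℕ)

/-! ## §1 The nine scalar letters at one `(β, δ, m)` -/

section Package

variable [NeZero L]

/-- ★ **THE UNIFORM `U ≡ 1` LAYER WITH THE BACKWARD PIECES** — the inductive datum dag-n15-w3's curved knit displays (`G(U)`, `D⁺_{R,μ}G(U)`, `D⁻_{R,μ}G(U)` on both grids +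
their three η-defects) READ AT KING's FULL `A = 0` PROPAGATOR, at ONE `(β, δ, m)`: for odd `L ≥ 3`, `a > 0`, `m₀² ≥ 0`, `0 ≤ γ < 1`, `0 < α < 1` there are `β, δ, m > 0` such
that for every `K ≥ 1`, `n ≥ 1`, cube `2L^e`, mass `0 < m² ≤ m₀²`, size datum `Msz` and direction `μ`: the six PLAIN block majorants `β·e^{−δ|y−y′|_T}` of `G`, `D⁺_μ`,
`D⁻_μ = S_{−μ}D⁺_μ` (coarse run) and `G′`, `D′⁺_μ`, `D′⁻_μ` (fine run), and the three η-DEFECT majorants `m·((L^K)^{−γ∕2} + (L^K)^{−α})·e^{−δ|y−y′|_T}` of `(G′, G)`,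
`(D′⁺_μ, D⁺_μ)`, `(D′⁻_μ, D⁻_μ)` through King's pairing. [cite: Balaban1985BackgroundPropagators, Thm 3.1 (3.42)–(3.43) pp.397–398, (3.52) p.400, (3.64) p.403 (shapes); King1986, (2.13)–(2.17) p.653, Prop. 3.9 (3.73) p.665; Balaban1983RegularityDecay, (1.9)–(1.10) p.573] -/
theorem kingFullProp_uniform_layer_backward (hLodd : Odd L) (hL : 2 ≤ L) {a : ℝ} (ha : 0 < a) {m0sq : ℝ} (hm0 : 0 ≤ m0sq) {γ : ℝ} (hγ0 : 0 ≤ γ)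
    (hγ1 : γ < 1) {α : ℝ} (hα0 : 0 < α) (hα1 : α < 1) :
    ∃ β δ m : ℝ, 0 < β ∧ 0 < δ ∧ 0 < m ∧ ∀ (K : ℕ), 1 ≤ K → ∀ (n : ℕ), 1 ≤ n → ∀ (e : ℕ) (M : Fin (d + 1) → ℕ) [∀ μ, NeZero (M μ)],
      (∀ μ, M μ = 2 * L ^ e) → ∀ (msq : ℝ), 0 < msq → msq ≤ m0sq → ∀ (Msz : ℝ) (μ : Fin (d + 1)),
      -- plain, coarse run: `G`, `D⁺_μ`, `D⁻_μ`
      HasMaj (BlockNorm.ofBlocks (unitTorusGeoS L K M Msz) (blockOf (L ^ K) M)) (BlockNorm.ofBlocks (unitTorusGeoS L K M Msz) (blockOf (L ^ K) M))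
          (kingGOp L a msq K (L ^ K) M) (fun y y' => β * Real.exp (-(δ * tdistT M y y')))
      ∧ HasMaj (BlockNorm.ofBlocks (unitTorusGeoS L K M Msz) (blockOf (L ^ K) M)) (BlockNorm.ofBlocks (unitTorusGeoS L K M Msz) (blockOf (L ^ K) M))
          (kingDOp L a msq K (L ^ K) M μ) (fun y y' => β * Real.exp (-(δ * tdistT M y y')))
      ∧ HasMaj (BlockNorm.ofBlocks (unitTorusGeoS L K M Msz) (blockOf (L ^ K) M)) (BlockNorm.ofBlocks (unitTorusGeoS L K M Msz) (blockOf (L ^ K) M))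
          (pull ⇑(Equiv.addRight (unitVec (fine (L ^ K) M) μ)).symm ∘ₗ kingDOp L a msq K (L ^ K) M μ) (fun y y' => β * Real.exp (-(δ * tdistT M y y')))
      -- plain, fine run: `G′`, `D′⁺_μ`, `D′⁻_μ`
      ∧ HasMaj (BlockNorm.ofBlocks (unitTorusGeoS L K M Msz) (blockOf (L ^ K) M ∘ underPtN L K n M))
          (BlockNorm.ofBlocks (unitTorusGeoS L K M Msz) (blockOf (L ^ K) M ∘ underPtN L K n M))
          (kingGOp L a msq (K + n) (L ^ n * L ^ K) M) (fun y y' => β * Real.exp (-(δ * tdistT M y y')))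
      ∧ HasMaj (BlockNorm.ofBlocks (unitTorusGeoS L K M Msz) (blockOf (L ^ K) M ∘ underPtN L K n M))
          (BlockNorm.ofBlocks (unitTorusGeoS L K M Msz) (blockOf (L ^ K) M ∘ underPtN L K n M))
          (kingDOp L a msq (K + n) (L ^ n * L ^ K) M μ) (fun y y' => β * Real.exp (-(δ * tdistT M y y')))
      ∧ HasMaj (BlockNorm.ofBlocks (unitTorusGeoS L K M Msz) (blockOf (L ^ K) M ∘ underPtN L K n M))
          (BlockNorm.ofBlocks (unitTorusGeoS L K M Msz) (blockOf (L ^ K) M ∘ underPtN L K n M))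
          (pull ⇑(Equiv.addRight (unitVec (fine (L ^ n * L ^ K) M) μ)).symm ∘ₗ kingDOp L a msq (K + n) (L ^ n * L ^ K) M μ)
          (fun y y' => β * Real.exp (-(δ * tdistT M y y')))
      -- the three two-grid defects
      ∧ HasMaj (BlockNorm.ofBlocks (unitTorusGeoS L K M Msz) (blockOf (L ^ K) M))
          (BlockNorm.ofBlocks (unitTorusGeoS L K M Msz) (blockOf (L ^ K) M ∘ underPtN L K n M))
          (idef (pull (underPtN L K n M)) (pull (underPtN L K n M)) (kingGOp L a msq (K + n) (L ^ n * L ^ K) M) (kingGOp L a msq K (L ^ K) M))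
          (fun y y' => m * (((L : ℝ) ^ K) ^ (-(γ / 2)) + ((L : ℝ) ^ K) ^ (-α)) * Real.exp (-(δ * tdistT M y y')))
      ∧ HasMaj (BlockNorm.ofBlocks (unitTorusGeoS L K M Msz) (blockOf (L ^ K) M))
          (BlockNorm.ofBlocks (unitTorusGeoS L K M Msz) (blockOf (L ^ K) M ∘ underPtN L K n M))
          (idef (pull (underPtN L K n M)) (pull (underPtN L K n M)) (kingDOp L a msq (K + n) (L ^ n * L ^ K) M μ) (kingDOp L a msq K (L ^ K) M μ))
          (fun y y' => m * (((L : ℝ) ^ K) ^ (-(γ / 2)) + ((L : ℝ) ^ K) ^ (-α)) * Real.exp (-(δ * tdistT M y y')))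
      ∧ HasMaj (BlockNorm.ofBlocks (unitTorusGeoS L K M Msz) (blockOf (L ^ K) M))
          (BlockNorm.ofBlocks (unitTorusGeoS L K M Msz) (blockOf (L ^ K) M ∘ underPtN L K n M))
          (idef (pull (underPtN L K n M)) (pull (underPtN L K n M))
            (pull ⇑(Equiv.addRight (unitVec (fine (L ^ n * L ^ K) M) μ)).symm ∘ₗ kingDOp L a msq (K + n) (L ^ n * L ^ K) M μ)
            (pull ⇑(Equiv.addRight (unitVec (fine (L ^ K) M) μ)).symm ∘ₗ kingDOp L a msq K (L ^ K) M μ))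
          (fun y y' => m * (((L : ℝ) ^ K) ^ (-(γ / 2)) + ((L : ℝ) ^ K) ^ (-α)) * Real.exp (-(δ * tdistT M y y'))) := by
  obtain ⟨β₁, δ₁, hβ₁, hδ₁, HG⟩ := hasMaj_kingGOp (d := d) L hLodd hL ha hm0
  obtain ⟨β₂, δ₂, hβ₂, hδ₂, HDc⟩ := hasMaj_kingDOp_coarse (d := d) L hLodd hL ha hm0
  obtain ⟨β₃, δ₃, hβ₃, hδ₃, HBc⟩ := hasMaj_kingDOpBack_coarse (d := d) L hLodd hL ha hm0
  obtain ⟨β₄, δ₄, hβ₄, hδ₄, HDf⟩ := hasMaj_kingDOp (d := d) L hLodd hL ha hm0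
  obtain ⟨β₅, δ₅, hβ₅, hδ₅, HBf⟩ := hasMaj_kingDOpBack_fine (d := d) L hLodd hL ha hm0
  obtain ⟨m₆, δ₆, hm₆, hδ₆, HIG⟩ := hasMaj_idef_kingGOp (d := d) L hLodd hL ha hm0 hγ0 hγ1
  obtain ⟨m₇, δ₇, hm₇, hδ₇, HID⟩ := hasMaj_idef_kingDOp (d := d) L hLodd hL ha hm0 hγ0 hγ1
  obtain ⟨m₈, δ₈, hm₈, hδ₈, HIB⟩ := hasMaj_idef_kingDOpBack (d := d) L hLodd hL ha hm0 hγ0 hγ1 hα0 hα1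
  -- one (β, δ, m): the largest constants, the smallest rate
  set δ : ℝ := min (min (min δ₁ δ₂) (min δ₃ δ₄)) (min (min δ₅ δ₆) (min δ₇ δ₈)) with hδdef
  have hδ : 0 < δ := lt_min (lt_min (lt_min hδ₁ hδ₂) (lt_min hδ₃ hδ₄)) (lt_min (lt_min hδ₅ hδ₆) (lt_min hδ₇ hδ₈))
  have hd1 : δ ≤ δ₁ := (min_le_left _ _).trans ((min_le_left _ _).trans (min_le_left _ _))
  have hd2 : δ ≤ δ₂ := (min_le_left _ _).trans ((min_le_left _ _).trans (min_le_right _ _))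
  have hd3 : δ ≤ δ₃ := (min_le_left _ _).trans ((min_le_right _ _).trans (min_le_left _ _))
  have hd4 : δ ≤ δ₄ := (min_le_left _ _).trans ((min_le_right _ _).trans (min_le_right _ _))
  have hd5 : δ ≤ δ₅ := (min_le_right _ _).trans ((min_le_left _ _).trans (min_le_left _ _))
  have hd6 : δ ≤ δ₆ := (min_le_right _ _).trans ((min_le_left _ _).trans (min_le_right _ _))
  have hd7 : δ ≤ δ₇ := (min_le_right _ _).trans ((min_le_right _ _).trans (min_le_left _ _))
  have hd8 : δ ≤ δ₈ := (min_le_right _ _).trans ((min_le_right _ _).trans (min_le_right _ _))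
  set β : ℝ := β₁ + β₂ + β₃ + β₄ + β₅ with hβdef
  have hβ : 0 < β := by positivity
  set m : ℝ := m₆ + m₇ + m₈ with hmdef
  have hm : 0 < m := by positivity
  refine ⟨β, δ, m, hβ, hδ, hm, fun K hK n hn e M _ hM msq hmsq hcap Msz μ => ?_⟩
  have hθ : 0 ≤ ((L : ℝ) ^ K) ^ (-(γ / 2)) := Real.rpow_nonneg (pow_nonneg (Nat.cast_nonneg _) _) _
  have hrα : 0 ≤ ((L : ℝ) ^ K) ^ (-α) := Real.rpow_nonneg (pow_nonneg (Nat.cast_nonneg _) _) _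
  have hsum : 0 ≤ ((L : ℝ) ^ K) ^ (-(γ / 2)) + ((L : ℝ) ^ K) ^ (-α) := add_nonneg hθ hrα
  -- a defect majorant `mᵢ·θ·e^{−δᵢd}` weakens to `m·(θ + θ′)·e^{−δd}`, and `mᵢ·(θ + θ′)·e^{−δᵢd}` likewise
  have weak1 : ∀ {X₁ X₂ : Type} [Fintype X₁] [Fintype X₂] {blk₁ : X₁ → Tor M} {blk₂ : X₂ → Tor M} {T : (X₁ → ℝ) →ₗ[ℝ] (X₂ → ℝ)} {mi δi : ℝ},
      0 ≤ mi → mi ≤ m → δ ≤ δi →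
      HasMaj (BlockNorm.ofBlocks (unitTorusGeoS L K M Msz) blk₁) (BlockNorm.ofBlocks (unitTorusGeoS L K M Msz) blk₂) T
        (fun y y' => mi * ((L : ℝ) ^ K) ^ (-(γ / 2)) * Real.exp (-(δi * tdistT M y y'))) →
      HasMaj (BlockNorm.ofBlocks (unitTorusGeoS L K M Msz) blk₁) (BlockNorm.ofBlocks (unitTorusGeoS L K M Msz) blk₂) T
        (fun y y' => m * (((L : ℝ) ^ K) ^ (-(γ / 2)) + ((L : ℝ) ^ K) ^ (-α)) * Real.exp (-(δ * tdistT M y y'))) :=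
    fun hmi hmim hδi h => hasMaj_exp_weaken L (mul_nonneg hmi hθ) (by nlinarith [mul_nonneg hmi hrα]) hδi h
  have weak2 : ∀ {X₁ X₂ : Type} [Fintype X₁] [Fintype X₂] {blk₁ : X₁ → Tor M} {blk₂ : X₂ → Tor M} {T : (X₁ → ℝ) →ₗ[ℝ] (X₂ → ℝ)} {mi δi : ℝ},
      0 ≤ mi → mi ≤ m → δ ≤ δi →
      HasMaj (BlockNorm.ofBlocks (unitTorusGeoS L K M Msz) blk₁) (BlockNorm.ofBlocks (unitTorusGeoS L K M Msz) blk₂) T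
        (fun y y' => mi * (((L : ℝ) ^ K) ^ (-(γ / 2)) + ((L : ℝ) ^ K) ^ (-α)) * Real.exp (-(δi * tdistT M y y'))) →
      HasMaj (BlockNorm.ofBlocks (unitTorusGeoS L K M Msz) blk₁) (BlockNorm.ofBlocks (unitTorusGeoS L K M Msz) blk₂) T
        (fun y y' => m * (((L : ℝ) ^ K) ^ (-(γ / 2)) + ((L : ℝ) ^ K) ^ (-α)) * Real.exp (-(δ * tdistT M y y'))) :=
    fun hmi hmim hδi h => hasMaj_exp_weaken L (mul_nonneg hmi hsum) (mul_le_mul_of_nonneg_right hmim hsum) hδi h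
  refine ⟨?_, ?_, ?_, ?_, ?_, ?_, ?_, ?_, ?_⟩
  · exact hasMaj_exp_weaken L hβ₁.le (by linarith) hd1 (HG K hK n e M hM msq hmsq hcap Msz).1
  · exact hasMaj_exp_weaken L hβ₂.le (by linarith) hd2 (HDc K hK e M hM msq hmsq hcap Msz μ)
  · exact hasMaj_exp_weaken L hβ₃.le (by linarith) hd3 (HBc K hK e M hM msq hmsq hcap Msz μ μ)
  · exact hasMaj_exp_weaken L hβ₁.le (by linarith) hd1 (HG K hK n e M hM msq hmsq hcap Msz).2
  · exact hasMaj_exp_weaken L hβ₄.le (by linarith) hd4 (HDf K hK n e M hM msq hmsq hcap Msz μ)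
  · exact hasMaj_exp_weaken L hβ₅.le (by linarith) hd5 (HBf K hK n e M hM msq hmsq hcap Msz μ μ)
  · exact weak1 hm₆.le (by linarith) hd6 (HIG K hK n hn e M hM msq hmsq hcap Msz)
  · exact weak1 hm₇.le (by linarith) hd7 (HID K hK n hn e M hM msq hmsq hcap Msz μ)
  · exact weak2 hm₈.le (by linarith) hd8 (HIB K hK n hn e M hM msq hmsq hcap Msz μ μ)


end Package

/-! ## §2 The flat-point ∕ lift dictionary -/

section Dictionary

variable {X : Type} (ι : Type)

/-- The lifted forward quotient after a componentwise lift is the lift of the forward quotient after the operator: `∇_{η}(T ⊗ 1) = (∇_{η}T) ⊗ 1`. [folklore] -/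
theorem fgrad_liftEquiv_comp_tensorId (c : ℝ) (s : X ≃ X) (T : (X → ℝ) →ₗ[ℝ] (X → ℝ)) :
    fgrad c (liftEquiv s ι) ∘ₗ tensorId ι T = tensorId ι (fgrad c s ∘ₗ T) := by
  refine LinearMap.ext fun f => funext fun p => ?_
  simp only [LinearMap.comp_apply, fgrad, LinearMap.smul_apply, LinearMap.sub_apply, Pi.smul_apply, Pi.sub_apply, pull_apply, liftEquiv_apply,
    LinearMap.id_apply, tensorId_apply, smul_eq_mul]

/-- The lifted BACKWARD quotient after a componentwise lift is the lift of the forward quotient after the operator, shifted back: `∇⁻_{η}(T ⊗ 1) = (S_{−}∇_{η}T) ⊗ 1`. [folklore] -/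
theorem bgrad_liftEquiv_comp_tensorId (c : ℝ) (s : X ≃ X) (T : (X → ℝ) →ₗ[ℝ] (X → ℝ)) :
    bgrad c (liftEquiv s ι) ∘ₗ tensorId ι T = tensorId ι (pull ⇑s.symm ∘ₗ (fgrad c s ∘ₗ T)) := by
  refine LinearMap.ext fun f => funext fun p => ?_
  simp only [LinearMap.comp_apply, bgrad, fgrad, LinearMap.smul_apply, LinearMap.sub_apply, Pi.smul_apply, Pi.sub_apply, pull_apply, liftEquiv_symm_apply,
    LinearMap.id_apply, tensorId_apply, smul_eq_mul, Equiv.apply_symm_apply]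

variable {ι} [Fintype ι] [DecidableEq ι] {𝔄 : Type} [NormedRing 𝔄] [NormedAlgebra ℝ 𝔄] (e : 𝔄 ≃L[ℝ] (ι → ℝ)) {J : Type}

/-- AT THE FLAT BASE POINT THE TRANSPORTER IS TRIVIAL: `e^{η·0} = 1` in coordinates. [cite: Balaban1985BackgroundPropagators, (3.50) p.400 (`R(U) = exp(iη ad)`: shape, at `U = 1`)] -/
theorem expTrField_zero (η : ℝ) : expTrField e η (0 : J → X → (𝔄 →L[ℝ] 𝔄)) = fun _ _ => 1 := by
  funext μ x
  rw [expTrField_apply, Pi.zero_apply, Pi.zero_apply, Phi0, smul_zero, NormedSpace.exp_zero, coordMat_one]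

/-- The block means of the zero field vanish. [folklore] -/
theorem blockMeanField_zero (Lb : ℕ) [NeZero Lb] (N : Fin (d + 1) → ℕ) [∀ μ, NeZero (N μ)] {V : Type} [NormedAddCommGroup V] [NormedSpace ℝ V] :
    blockMeanField Lb N (0 : Fin (d + 1) → Tor (fine Lb N) → V) = 0 := by
  funext μ b
  simp only [blockMeanField, blockMeanTV, Pi.zero_apply, Finset.sum_const_zero, smul_zero]

end Dictionary

/-! ## §3 King's objects on dag-n15-w3's pairing: the lifts, the cast-conjugate fine propagator, and the operator identities -/

section Objects

variable [NeZero L] (a msq : ℝ) (K : ℕ) (M : Fin (d + 1) → ℕ) [∀ μ, NeZero (M μ)]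

/-- `A₀′⁻¹` ONE LEVEL UP (`K + 1` levels, `L^1·L^K` η′-sites per unit block) READ ON dag-n15-w3's fine torus `Tor (fine L (fine (L^K) M))` through part Ω-a's cast.
[cite: King1986, (4.1)–(4.5) p.670, (2.20) p.654 (re-indexing)] -/
def kingGOp₁ : (Tor (fine L (fine (L ^ K) M)) → ℝ) →ₗ[ℝ] (Tor (fine L (fine (L ^ K) M)) → ℝ) :=
  pull ⇑(castT L K M) ∘ₗ kingGOp L a msq (K + 1) (L ^ 1 * L ^ K) M ∘ₗ pull ⇑(castT L K M).symm

variable (ι : Type) [Fintype ι] [DecidableEq ι]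

/-- `G = A₀⁻¹ ⊗ 1_ι` on the coarse torus (dag-n15-c's componentwise lift). [cite: King1986, (4.1)–(4.5) p.670; Balaban1984PropagatorsII, (2.156) p.250 (shape)] -/
def kingGT : (Tor (fine (L ^ K) M) × ι → ℝ) →ₗ[ℝ] (Tor (fine (L ^ K) M) × ι → ℝ) := tensorId ι (kingGOp L a msq K (L ^ K) M)

/-- `G′ = A₀′⁻¹ ⊗ 1_ι` on the fine torus. [cite: King1986, (4.1)–(4.5) p.670; Balaban1984PropagatorsII, (2.156) p.250 (shape)] -/
def kingGT₁ : (Tor (fine L (fine (L ^ K) M)) × ι → ℝ) →ₗ[ℝ] (Tor (fine L (fine (L ^ K) M)) × ι → ℝ) := tensorId ι (kingGOp₁ L a msq K M)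

variable {ι}

omit [NeZero L] [∀ μ, NeZero (M μ)] in
/-- dag-n15-b's torus-line unit vector IS [B5]'s (`Pi.single μ 1` both). [folklore] -/
theorem kingTorusLine_unitVec_eq (N : Fin (d + 1) → ℕ) (μ : Fin (d + 1)) :
    Summit.QuantumFields.YangMills.BalabanUVNodes.N15.KingTorusLine.unitVec N μ = unitVec N μ := rfl

omit [NeZero L] [∀ μ, NeZero (M μ)] in
/-- The forward quotient on dag-n15-w3's fine torus intertwines with the cast (a translation homomorphism): `∇′(cast∘T∘cast⁻¹) = cast∘(∇′T)∘cast⁻¹`. [cite: King1986, (2.20) p.654] -/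
theorem fgrad_comp_conj (c : ℝ) (μ : Fin (d + 1)) (T : (Tor (fine (L ^ 1 * L ^ K) M) → ℝ) →ₗ[ℝ] (Tor (fine (L ^ 1 * L ^ K) M) → ℝ)) :
    fgrad c (torStep (fine L (fine (L ^ K) M)) μ) ∘ₗ (pull ⇑(castT L K M) ∘ₗ T ∘ₗ pull ⇑(castT L K M).symm) =
      pull ⇑(castT L K M) ∘ₗ (fgrad c (Equiv.addRight (unitVec (fine (L ^ 1 * L ^ K) M) μ)) ∘ₗ T) ∘ₗ pull ⇑(castT L K M).symm := by
  refine LinearMap.ext fun f => funext fun y' => ?_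
  simp only [LinearMap.comp_apply, fgrad, torStep, kingTorusLine_unitVec_eq, LinearMap.smul_apply, LinearMap.sub_apply, Pi.smul_apply, Pi.sub_apply,
    pull_apply, Equiv.coe_addRight, LinearMap.id_apply, castT_add_unitVec]

omit [NeZero L] [∀ μ, NeZero (M μ)] in
/-- The backward shift intertwines with the cast: `S′_{−μ}(cast∘T∘cast⁻¹) = cast∘(S_{−μ}T)∘cast⁻¹`. [cite: King1986, (2.20) p.654] -/
theorem pullBack_comp_conj (μ : Fin (d + 1)) (T : (Tor (fine (L ^ 1 * L ^ K) M) → ℝ) →ₗ[ℝ] (Tor (fine (L ^ 1 * L ^ K) M) → ℝ)) :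
    pull ⇑(torStep (fine L (fine (L ^ K) M)) μ).symm ∘ₗ (pull ⇑(castT L K M) ∘ₗ T ∘ₗ pull ⇑(castT L K M).symm) =
      pull ⇑(castT L K M) ∘ₗ (pull ⇑(Equiv.addRight (unitVec (fine (L ^ 1 * L ^ K) M) μ)).symm ∘ₗ T) ∘ₗ pull ⇑(castT L K M).symm := by
  refine LinearMap.ext fun f => funext fun y' => ?_
  simp only [LinearMap.comp_apply, pull_apply, torStep_symm_apply, kingTorusLine_unitVec_eq, addRight_symm_apply', castT_sub_unitVec]

/-- The block of a point read back through the cast is King's pairing. [cite: King1986, p.664 (pairing)] -/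
theorem blockOf_castT_symm (z : Tor (fine (L ^ 1 * L ^ K) M)) : blockOf L (fine (L ^ K) M) ((castT L K M).symm z) = underPtN L K 1 M z := by
  rw [← underPtN_castT, Equiv.apply_symm_apply]

/-- Pulling a coarse field up by the one-step block map and reading it through the cast IS pulling it up by King's pairing. [cite: King1986, p.664 (pairing)] -/
theorem pull_castSymm_pull_blockOf (f : Tor (fine (L ^ K) M) → ℝ) :
    pull ⇑(castT L K M).symm (pull (blockOf L (fine (L ^ K) M)) f) = pull (underPtN L K 1 M) f := by
  funext z
  rw [pull_apply, pull_apply, pull_apply, blockOf_castT_symm]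

/-- ★ THE TWO-GRID DEFECT THROUGH THE ONE-STEP BLOCK MAP of a cast-conjugate fine operator IS the rung's defect through King's pairing, read through the cast:
`𝔇_{blockOf}(cast∘T′∘cast⁻¹, T) = cast∘𝔇_π(T′, T)`. [cite: King1986, p.664 (pairing), (2.20) p.654] -/
theorem idef_conj_eq (T' : (Tor (fine (L ^ 1 * L ^ K) M) → ℝ) →ₗ[ℝ] (Tor (fine (L ^ 1 * L ^ K) M) → ℝ))
    (T : (Tor (fine (L ^ K) M) → ℝ) →ₗ[ℝ] (Tor (fine (L ^ K) M) → ℝ)) :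
    idef (pull (blockOf L (fine (L ^ K) M))) (pull (blockOf L (fine (L ^ K) M))) (pull ⇑(castT L K M) ∘ₗ T' ∘ₗ pull ⇑(castT L K M).symm) T =
      pull ⇑(castT L K M) ∘ₗ idef (pull (underPtN L K 1 M)) (pull (underPtN L K 1 M)) T' T := by
  refine LinearMap.ext fun f => ?_
  rw [idef_apply, LinearMap.comp_apply, LinearMap.comp_apply, LinearMap.comp_apply, pull_castSymm_pull_blockOf, idef_apply]
  funext y'
  rw [Pi.sub_apply, pull_apply, pull_apply, pull_apply, Pi.sub_apply, pull_apply, underPtN_castT]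

omit [NeZero L] [∀ μ, NeZero (M μ)] in
/-- The fine spacing is `η′ = (L^1·L^K)⁻¹`: `η′⁻¹ = L^1·L^K`. [folklore] -/
theorem inv_etaFine : (((L : ℝ) ^ (K + 1))⁻¹)⁻¹ = ((L ^ 1 * L ^ K : ℕ) : ℝ) := by
  rw [inv_inv]; push_cast; ring

omit [∀ μ, NeZero (M μ)] in
/-- The coarse spacing is `Lη′ = (L^K)⁻¹`: `(Lη′)⁻¹ = L^K` (`L ≠ 0`). [folklore] -/
theorem inv_etaCoarse : ((L : ℝ) * ((L : ℝ) ^ (K + 1))⁻¹)⁻¹ = ((L ^ K : ℕ) : ℝ) := by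
  have hL : (L : ℝ) ≠ 0 := Nat.cast_ne_zero.mpr (NeZero.ne L)
  rw [mul_inv, inv_inv, pow_succ]; push_cast; field_simp

/-- FLAT POINT, COARSE, FORWARD: the knit's piece `D⁺_{1,μ}G` at `G = A₀⁻¹ ⊗ 1` is `(N∇_μA₀⁻¹) ⊗ 1`. [cite: Balaban1985BackgroundPropagators, (3.64) p.403 (shape)] -/
theorem covPieces_flat_coarse_inl (μ : Fin (d + 1)) :
    covPieces ((L : ℝ) * ((L : ℝ) ^ (K + 1))⁻¹) (torStep (fine (L ^ K) M)) (fun _ _ => (1 : Matrix ι ι ℝ)) (kingGT L a msq K M ι) (Sum.inl μ) =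
      tensorId ι (kingDOp L a msq K (L ^ K) M μ) := by
  rw [covPieces_one, Sum.elim_inl, kingGT, fgrad_liftEquiv_comp_tensorId, inv_etaCoarse L K]
  rfl

/-- FLAT POINT, COARSE, BACKWARD: `D⁻_{1,μ}G` at `G = A₀⁻¹ ⊗ 1` is `(S_{−μ}N∇_μA₀⁻¹) ⊗ 1`. [cite: Balaban1985BackgroundPropagators, (3.64) p.403 (shape)] -/
theorem covPieces_flat_coarse_inr (μ : Fin (d + 1)) :
    covPieces ((L : ℝ) * ((L : ℝ) ^ (K + 1))⁻¹) (torStep (fine (L ^ K) M)) (fun _ _ => (1 : Matrix ι ι ℝ)) (kingGT L a msq K M ι) (Sum.inr μ) =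
      tensorId ι (pull ⇑(Equiv.addRight (unitVec (fine (L ^ K) M) μ)).symm ∘ₗ kingDOp L a msq K (L ^ K) M μ) := by
  rw [covPieces_one, Sum.elim_inr, kingGT, bgrad_liftEquiv_comp_tensorId, inv_etaCoarse L K]
  rfl

/-- FLAT POINT, FINE, FORWARD: `D′⁺_{1,μ}G′` is `cast∘(N′∇′_μA₀′⁻¹)∘cast⁻¹ ⊗ 1`. [cite: Balaban1985BackgroundPropagators, (3.64) p.403 (shape); King1986, (2.20) p.654] -/
theorem covPieces_flat_fine_inl (μ : Fin (d + 1)) :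
    covPieces (((L : ℝ) ^ (K + 1))⁻¹) (torStep (fine L (fine (L ^ K) M))) (fun _ _ => (1 : Matrix ι ι ℝ)) (kingGT₁ L a msq K M ι) (Sum.inl μ) =
      tensorId ι (pull ⇑(castT L K M) ∘ₗ kingDOp L a msq (K + 1) (L ^ 1 * L ^ K) M μ ∘ₗ pull ⇑(castT L K M).symm) := by
  rw [covPieces_one, Sum.elim_inl, kingGT₁, fgrad_liftEquiv_comp_tensorId, inv_etaFine L K, kingGOp₁, fgrad_comp_conj]
  rfl

/-- FLAT POINT, FINE, BACKWARD: `D′⁻_{1,μ}G′` is `cast∘(S′_{−μ}N′∇′_μA₀′⁻¹)∘cast⁻¹ ⊗ 1`. [cite: Balaban1985BackgroundPropagators, (3.64) p.403 (shape); King1986, (2.20) p.654] -/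
theorem covPieces_flat_fine_inr (μ : Fin (d + 1)) :
    covPieces (((L : ℝ) ^ (K + 1))⁻¹) (torStep (fine L (fine (L ^ K) M))) (fun _ _ => (1 : Matrix ι ι ℝ)) (kingGT₁ L a msq K M ι) (Sum.inr μ) =
      tensorId ι (pull ⇑(castT L K M) ∘ₗ (pull ⇑(Equiv.addRight (unitVec (fine (L ^ 1 * L ^ K) M) μ)).symm ∘ₗ kingDOp L a msq (K + 1) (L ^ 1 * L ^ K) M μ) ∘ₗ
        pull ⇑(castT L K M).symm) := by
  rw [covPieces_one, Sum.elim_inr, kingGT₁, bgrad_liftEquiv_comp_tensorId, inv_etaFine L K, kingGOp₁, fgrad_comp_conj, pullBack_comp_conj]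
  rfl

end Objects

end Summit.QuantumFields.YangMills.BalabanUVNodes.N15KingModelRung.Curved

end
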